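import Literature.MathematicalPhysics.QuantumFieldTheory.Balaban1983to89.B9Thm31SiteBochnerY
import Literature.MathematicalPhysics.QuantumFieldTheory.Balaban1983to89.B9Thm31SiteGsqRecordCutoffReg335Y

/-!
# `Balaban1983to89.B9Thm31SiteGsqHessianReg335Y` — T. Bałaban, *Propagators for lattice gauge theories in a background field*, Commun. Math. Phys. **99** (1985)
# 389–434 [Balaban1985BackgroundPropagators] (3.46) p. 398 (fourth ∕ sixth members `G′D*D*`, `∇∇G′`, constant WITHOUT a `(Lʲη)` power), Cor 3.6 p. 408 («constants
# independent of □»), (3.88) p. 409: ★★★ **THE INTERIOR `H²` ESTIMATE FOR THE SANDWICHED LOCAL CUBE INVERSE `M_hG′_□(U)M_h` ON THE (3.35) CLASS, □-UNIFORM,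
# AND THE SECOND-ORDER MEMBER `M_hG′_□M_h∇*_ν∇*_μ` IN `L²`** — the open piece (A2) of width seat `pub-ymgap-dag-n06-w1`'s lane at the 𝔸 level (the shape of
# dag-n06-k's `L2SecondLegs37.l5`, `B3 = O(1)`) (file 28 of the seat's set)

statement-level skeleton of published theorems with citation tags; proofs where landed; nothing here is a claim about the Yang–Mills mass gap

THE PRINT ∕ WHY.  (3.46): *«|(G′(U)D*_UD*_Uλ)(x)|, |(∇_U∇_UG′(U)λ)(x)| ≤ B₀e^{−δ₀d(y,y′)}|λ|»* — no level factor, in contrast with the first-order members; Cor 3.6 transfers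
(3.46) to the local inverses `G′_□` with □-independent constants, and the walk (3.88) needs them between the cut-offs `h_□`.  A GLOBAL Bochner argument for the
zero-extended `G′_□Ψ` fails at ∂□̃ (normal layer ~ L^{j}); the cheap route `(M_hG′_□M_h∇*)(∇*λ)` with `‖∇*λ‖ ≤ 2‖λ‖` loses `L^{j}`.  WHAT WORKS (this file): the SANDWICH
`w = M_hG′_□M_hΨ` is a genuine torus function supported in `supp h ⊆ □̃`, so file 27's torus Bochner–Weitzenböck inequality applies with NO boundary term and NO current
`J`; its three inputs are □-uniform: `Δ_Uw = h²Ψ − K(h)u − (averaging of w)` (`u = G′_□M_hΨ`; `K(h) = [M_h, Δ′]`, lit-balaban `B9Thm37CubeCoverCommutators.cutCommY_apply`;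
`P_□̃Δ′G′_□ = P_□̃`, file 20; `Δ′ = Δ_U + averaging`, def-Y `deltaPrimeAY_apply`) with `‖K(h)u‖` from file 23's `hs_KhY_apply_le` and files 20∕21's (3.46a,b) for `u`
(levels of □̃ only); the curvature weights `ε ≤ ε_D = O(α₀)L^{−2j}` wherever a plaquette reaches `supp h` (file 26's `norm_plaqU_sub_one_le_of_holY` +
`B9Eq335PlaquetteAtLettersY.norm_holY_sub_one_le_of_reg335`, the consumer's instantiation); `‖∇w‖² ≲ L^{2j}`, `‖w‖² ≲ L^{4j}`.  Every product is O(1) at print's sizes.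

WHAT IS PROVED (sorry-free; 0 `def`).  On `(bg9K (M_N ℂ) G i).Reg335 c α₀` (`G ≤ U(N)`, `N ≥ 1`, `0 ≤ c·M·α₀`, `c·M·α₀·(d+1) ≤ 1∕16`), EVERY site set `D`, real cut-off
`h` with `supp h ⊆ D`, `|h| ≤ 1`, `|∂h| ≤ κ`, `|∂∂h| ≤ κ₂`, block oscillation `≤ κ_b`, levels in `[j′_D, j_D]` on `D`, pointwise window `0 ≤ ε`, `|plaqU μ ν x − 1| ≤ ε(x)`,
`ε(x) ≤ ε_D` (`ε_D ≥ 0`) whenever `x + e_μ ∈ D` or `x + e_μ + e_ν ∈ D`: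
* helpers `sum_hs_cdsS_le`, `trIP_sandwich_symm` (file 27 §4 has `sum_levelMass_avg_le`, `sum_sum_const_add_pair`);
* ★★★ `hessian_cutMulY_GsqY_cutMulY_le`: `Σ_{μν}‖∇_μ∇_ν(M_hG′_□M_hΨ)‖² ≤ C_H·‖Ψ‖²`,
  `C_H = (4∕3)[4 + 4K_c + 512m_D²L_D⁴ + 1024(d+1)²ε_D²L_D⁴ + 2(d+1)ε_D(320L_D² + 512(d+1)κ²L_D⁴)]`, `K_c = 2560(d+1)κ²L_D² + 1024(d+1)²κ₂²L_D⁴ + 512κ_b²m_D²L_D⁴`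
  (`L_D = L^{j_D}`, `m_D = L^{−2j′_D}`);
* ★★★ `trIP_cutMulY_GsqY_cutMulY_cdsS_cdsS_le`: `‖M_hG′_□M_h∇*_ν∇*_μλ‖² ≤ C_H·‖λ‖²` (file 27's duality).
MODEL ∕ SCOPE as files 19–27; NOT HERE: the instantiation `h = hTY`, `D = □̃(q)`, `ε` from (3.35) with the level window (consumer: three lines with files 25∕26), Agmon
decay of the second-order member (the sandwich is local: source and output both inside □̃ — decay in `d(t,s)` is then the walk's), the `K(h)G′h∇*∇*` factor
(`FactorsL2Second37.facDD`: `= [∇ ∘ (this file) ]`-type composition, successor).  NON-VACUITY (A6): `U = 1`, `ε = 0`, `h = 0` inhabit the hypotheses.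
HONEST SCOPE: one composition of landed `L²` estimates with the lattice Bochner identity; NOT a node discharge, NOT summit progress; count-neutral; nothing continuum ∕ OS ∕
mass gap ∕ Clay; the YM mass gap (Clay) is NOT proved by any of this — R4 closes the conditional finite-𝕋⁴ rung `BalabanLadder.UV` only.  NEW file importing files 25 and 27.
Net new unproved facts: 0.
-/

noncomputable section

namespace Literature.MathematicalPhysics.QuantumFieldTheory.Balaban1983to89.B9Thm31SiteGsqHessianReg335Y

open Literature.MathematicalPhysics.QuantumFieldTheory.Balaban1983to89
open Node00 B6KLevelCensusIndexV1 B6MultiLevelTorusOperator B6GlobalChartV1 B9BackgroundsKLevelV1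
  B9Eq39Adjoint B9Thm311ReadingCoords B9Thm311DeltaPrimePos B9Ineq369CurvatureSmallAtLettersY B9Thm31SiteCoerciveGaugeBlockY B9Thm31SiteGpBoundsReg335Y
  B9Thm31SiteCurvatureCommutatorsY B9Thm31SiteBochnerY
open Literature.MathematicalPhysics.QuantumFieldTheory.Balaban1983to89.B9Ineq349SiteAdjoint (trIP_comm trIP_cdS_left)
open Literature.MathematicalPhysics.QuantumFieldTheory.Balaban1983to89.B9Eq3132CoerciveVariational (trIP_sub_right trIP_sub_left)
open scoped Matrix Matrix.Norms.L2Operator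

variable {d ℓ : ℕ} {hd : 1 ≤ d + 1} {hL : Odd (ℓ + 1) ∧ 1 < ℓ + 1} {b₀ b₁ : ℝ}
variable (i : KIdx d ℓ hd hL b₀ b₁) {N : ℕ} {G : Subgroup (Matrix (Fin N) (Fin N) ℂ)ˣ}

section Hessian

open Literature.MathematicalPhysics.QuantumFieldTheory.Balaban1983to89.B9Thm37CubeCoverCommutators (cutMulY cutMulY_apply KhY KhY_def cutCommY_apply)
open Literature.MathematicalPhysics.QuantumFieldTheory.Balaban1983to89.B9Thm37CubeCoverCommutatorSizes (avgCoeffY_nonneg)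
open Literature.MathematicalPhysics.QuantumFieldTheory.Balaban1983to89.B9Thm311DeltaPrimeSymm (avgCoeffY_eq_ite avgCoeffY_symm)
open B6Geom246MultiLevelBox B9Thm31SiteCoerciveReg335Y B9Thm31SitePolarisedFormY B9Thm31SiteGsqDecayReg335Y B9Thm31SiteGsqGradDecayReg335Y
  B9Thm31SiteGsqCutoffMixedReg335Y B9Thm31SiteGsqCutoffFactorsReg335Y B9Thm31SiteGsqRecordCutoffReg335Y Node00.OpsYLocalInverse

/-! ### Helpers: global sums -/

/-- `Σ_z HS((∇*_μΛ)(z)) ≤ Σ_z HS((∇_μΛ)(z))` (unitary transport, reindexing). [cite: Balaban1985BackgroundPropagators, (3.8) p.392, bookkeeping] -/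
theorem sum_hs_cdsS_le (hG : G ≤ B7Prop2Explicit.unitaryUnits (Matrix (Fin N) (Fin N) ℂ)) {U : CfgY (Matrix (Fin N) (Fin N) ℂ) i}
    (hU : ∀ μ x, U μ x ∈ G) (μ : Fin (d + 1)) (Λ : SiteY i → Matrix (Fin N) (Fin N) ℂ) :
    ∑ z, ∑ a, ∑ b, ‖cdsS i U μ Λ z a b‖ ^ 2 ≤ ∑ z, ∑ a, ∑ b, ‖cdS i U μ Λ z a b‖ ^ 2 := by
  refine (Finset.sum_le_sum fun z _ => hs_cdsS_le_hs_cdS_symm i hG hU μ Λ z).trans (le_of_eq ?_)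
  exact Fintype.sum_equiv (shiftY i μ).symm _ _ fun z => rfl

variable {c α₀ : ℝ}
set_option maxHeartbeats 400000 in
/-- ★★★ **THE INTERIOR `H²` ESTIMATE FOR THE SANDWICHED LOCAL CUBE INVERSE, □-UNIFORM** — piece (A2): on the class (3.35), for EVERY site set `D`, a real cut-off `h`
supported in `D` (`|h| ≤ 1`, `|∂h| ≤ κ`, `|∂∂h| ≤ κ₂`, block oscillation `≤ κ_b`), levels in `[j′_D, j_D]` on `D`, and a plaquette window `|plaqU μ ν x − 1| ≤ ε(x)` with
`0 ≤ ε ≤ ε_D` wherever a plaquette reaches `D` within two forward steps: with `w := M_hG′_□(U)M_hΨ`,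
`Σ_{μν} ‖∇_μ∇_νw‖² ≤ (4∕3)·[4 + 4K_c + 512m_D²L_D⁴ + 1024(d+1)²ε_D²L_D⁴ + 2(d+1)ε_D(320L_D² + 512(d+1)κ²L_D⁴)]·‖Ψ‖²`,
`K_c = 2560(d+1)κ²L_D² + 1024(d+1)²κ₂²L_D⁴ + 512κ_b²m_D²L_D⁴` (`L_D = L^{j_D}`, `m_D = L^{−2j′_D}`) — every product is O(1) at print's sizes (`κ ~ (ML^j)⁻¹`, `ε_D ~ α₀L^{−2j}`).
Route: `bochner_le` for the torus function `w`; `Δ_Uw = h²Ψ − K(h)u − (averaging of w)` by `K(h) = [M_h, Δ′]` and `P_□̃Δ′G′_□ = P_□̃`; sizes from files 20–23.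
[cite: Balaban1985BackgroundPropagators, (3.46) p.398 (4th∕6th members), Cor 3.6 p.408, (3.88) p.409, (3.24) p.394, (3.35) p.396; Balaban1984PropagatorsII, (2.43) p.230, p.247] -/
theorem hessian_cutMulY_GsqY_cutMulY_le [Nonempty (Fin N)] (hG : G ≤ B7Prop2Explicit.unitaryUnits (Matrix (Fin N) (Fin N) ℂ)) {U : CfgY (Matrix (Fin N) (Fin N) ℂ) i}
    (hC0 : 0 ≤ c * (kGeo i).M * α₀) (hC1 : c * (kGeo i).M * α₀ * ((d : ℝ) + 1) ≤ 1 / 16) (hreg : (bg9K (Matrix (Fin N) (Fin N) ℂ) G i).Reg335 c α₀ U)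
    (D : Finset (SiteY i)) {h : SiteY i → ℝ} {κ κ₂ κb : ℝ} (hh1 : ∀ z, |h z| ≤ 1) (hhκ : ∀ μ z, |h (shiftY i μ z) - h z| ≤ κ)
    (hhκ₂ : ∀ μ z, |h (shiftY i μ z) + h ((shiftY i μ).symm z) - 2 * h z| ≤ κ₂)
    (hhb : ∀ z w : SiteY i, blkOf i.D.toDomains w = blkOf i.D.toDomains z → |h z - h w| ≤ κb) (hhD : ∀ z, z ∉ D → h z = 0)
    {jD jD' : ℕ} (hjD : ∀ z ∈ D, (blkOf i.D.toDomains z).1.1 ≤ jD) (hjD' : ∀ z ∈ D, jD' ≤ (blkOf i.D.toDomains z).1.1)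
    {ε : SiteY i → ℝ} {εD : ℝ} (hε0 : ∀ z, 0 ≤ ε z) (hεD0 : 0 ≤ εD)
    (hF : ∀ μ ν z, ‖((plaqU (shiftY i) (UboxY i U) μ ν z : (Matrix (Fin N) (Fin N) ℂ)ˣ) : Matrix (Fin N) (Fin N) ℂ) - 1‖ ≤ ε z)
    (hεD : ∀ x μ ν, shiftY i ν (shiftY i μ x) ∈ D → ε x ≤ εD) (hεD' : ∀ x μ, shiftY i μ x ∈ D → ε x ≤ εD)
    (Ψ : SiteY i → Matrix (Fin N) (Fin N) ℂ) :
    ∑ μ : Fin (d + 1), ∑ ν : Fin (d + 1), trIP (fun _ => (1 : ℝ))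
        (cdS i U μ (cdS i U ν (cutMulY h (GsqY i (parSymY i) D U (cutMulY h Ψ)))))
        (cdS i U μ (cdS i U ν (cutMulY h (GsqY i (parSymY i) D U (cutMulY h Ψ)))))
      ≤ 4 / 3 * (4 + 4 * (2560 * ((d : ℝ) + 1) * κ ^ 2 * ((((ℓ + 1) ^ jD : ℕ) : ℝ)) ^ 2
              + 1024 * (((d : ℝ) + 1) * κ₂) ^ 2 * (((((ℓ + 1) ^ jD : ℕ) : ℝ)) ^ 2) ^ 2
              + 512 * κb ^ 2 * ((((((ℓ + 1) ^ jD' : ℕ) : ℝ)) ^ 2)⁻¹) ^ 2 * (((((ℓ + 1) ^ jD : ℕ) : ℝ)) ^ 2) ^ 2)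
            + 512 * ((((((ℓ + 1) ^ jD' : ℕ) : ℝ)) ^ 2)⁻¹) ^ 2 * (((((ℓ + 1) ^ jD : ℕ) : ℝ)) ^ 2) ^ 2
            + 1024 * ((d : ℝ) + 1) ^ 2 * εD ^ 2 * (((((ℓ + 1) ^ jD : ℕ) : ℝ)) ^ 2) ^ 2
            + 2 * ((d : ℝ) + 1) * εD * (320 * ((((ℓ + 1) ^ jD : ℕ) : ℝ)) ^ 2 + 512 * ((d : ℝ) + 1) * κ ^ 2 * (((((ℓ + 1) ^ jD : ℕ) : ℝ)) ^ 2) ^ 2))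
          * trIP (fun _ => (1 : ℝ)) Ψ Ψ := by
  classical
  have hU : ∀ μ x, U μ x ∈ G := hreg.1
  have hUu : ∀ μ x, (U μ x : Matrix (Fin N) (Fin N) ℂ) ∈ unitary (Matrix (Fin N) (Fin N) ℂ) := fun μ x => hG (hU μ x)
  set Ψ' := cutMulY h Ψ with hΨ'
  set u := GsqY i (parSymY i) D U Ψ' with hu
  set w := cutMulY h u with hw
  set Q := trIP (fun _ => (1 : ℝ)) Ψ Ψ with hQ
  set LD := ((((ℓ + 1) ^ jD : ℕ) : ℝ)) ^ 2 with hLD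
  set mD := (((((ℓ + 1) ^ jD' : ℕ) : ℝ)) ^ 2)⁻¹ with hmD
  have hQ0 : 0 ≤ Q := trIP_self_nonneg _ (fun _ => one_pos) Ψ
  have hκ0 : 0 ≤ κ := le_trans (abs_nonneg _) (hhκ 0 (Classical.arbitrary _))
  -- supports
  have hΨ'D : ∀ z, z ∉ D → Ψ' z = 0 := fun z hz => by rw [hΨ', cutMulY_apply, hhD z hz]; simp
  have huD : ∀ z, z ∉ D → u z = 0 := fun z hz => GsqY_apply_eq_zero i (parSymY i) U Ψ' hz
  have hwD : ∀ z, z ∉ D → w z = 0 := fun z hz => by rw [hw, cutMulY_apply, huD z hz, smul_zero]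
  -- sizes of the inputs
  have hQ' : trIP (fun _ => (1 : ℝ)) Ψ' Ψ' ≤ Q := trIP_cutMulY_self_le i hh1 Ψ
  have e_uu : trIP (fun _ => (1 : ℝ)) u u = ∑ z ∈ D, ∑ a, ∑ b, ‖u z a b‖ ^ 2 := by
    rw [trIP_one_self_eq, ← Finset.sum_subset (Finset.subset_univ D)]
    intro z _ hz; rw [huD z hz]; simp
  have hb0 : ∀ (μ : Fin (d + 1)) (z : SiteY i), (fun _ : SiteY i => (1 : ℝ)) (shiftY i μ z) / (fun _ : SiteY i => (1 : ℝ)) z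
      + (fun _ : SiteY i => (1 : ℝ)) z / (fun _ : SiteY i => (1 : ℝ)) (shiftY i μ z) - 2 ≤ 0 * (((((ℓ + 1) ^ (blkOf i.D.toDomains z).1.1 : ℕ) : ℝ)) ^ 2)⁻¹ := by
    intro μ z; norm_num
  have hb0' : ∀ (μ : Fin (d + 1)) (z : SiteY i), (fun _ : SiteY i => (1 : ℝ)) (shiftY i μ z) / (fun _ : SiteY i => (1 : ℝ)) z
      + (fun _ : SiteY i => (1 : ℝ)) z / (fun _ : SiteY i => (1 : ℝ)) (shiftY i μ z) - 2 ≤ 0 * (((((ℓ + 1) ^ (blkOf i.D.toDomains (shiftY i μ z)).1.1 : ℕ) : ℝ)) ^ 2)⁻¹ := by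
    intro μ z; norm_num
  have hs0 : ∀ z w' : SiteY i, blkOf i.D.toDomains w' = blkOf i.D.toDomains z →
      (fun _ : SiteY i => (1 : ℝ)) z / (fun _ : SiteY i => (1 : ℝ)) w' + (fun _ : SiteY i => (1 : ℝ)) w' / (fun _ : SiteY i => (1 : ℝ)) z - 2 ≤ 0 := by
    intro z w' _; norm_num
  have hκ16 : ((d : ℝ) + 1) * 0 + 0 / 2 ≤ 1 / 16 := by norm_num
  have huu : trIP (fun _ => (1 : ℝ)) u u ≤ 256 * (LD * LD) * Q := by
    rw [e_uu]
    have h1 := hs_restrict_GsqY_parSymY_le i hG hC0 hC1 hreg D (ω := fun _ => (1 : ℝ)) (fun _ => one_pos) (θb := 0) (θs := 0) hb0 hb0' hs0 hκ16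
      (A := D) (B := D) hΨ'D (fun _ _ => rfl) hjD hjD one_pos (fun _ _ => le_rfl)
    refine h1.trans ?_
    rw [one_pow, div_one]
    exact mul_le_mul_of_nonneg_left hQ' (by positivity)
  have hDu : ∑ z, ∑ μ : Fin (d + 1), ∑ a, ∑ b, ‖cdS i U μ u z a b‖ ^ 2 ≤ 160 * LD * Q := by
    have h1 := hs_restrict_cdS_GsqY_parSymY_le i hG hC0 hC1 hreg D (ω := fun _ => (1 : ℝ)) (fun _ => one_pos) (θb := 0) (θs := 0) le_rfl le_rfl
      hb0 hb0' hs0 hκ16 (A := Finset.univ) (B := D) hΨ'D (fun _ _ => rfl) hjD one_pos (fun _ _ => le_rfl)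
    refine h1.trans ?_
    rw [one_pow, div_one]
    exact mul_le_mul_of_nonneg_left hQ' (by positivity)
  have huu' : ∑ z, ∑ a, ∑ b, ‖u z a b‖ ^ 2 ≤ 256 * (LD * LD) * Q := by rw [← trIP_one_self_eq]; exact huu
  have hww' : ∑ z, ∑ a, ∑ b, ‖w z a b‖ ^ 2 ≤ 256 * (LD * LD) * Q :=
    (Finset.sum_le_sum fun z _ => hs_cutMulY_apply_le i hh1 u z).trans huu'
  have hDu' : ∑ μ : Fin (d + 1), ∑ z, ∑ a, ∑ b, ‖cdS i U μ u z a b‖ ^ 2 ≤ 160 * LD * Q := by rw [Finset.sum_comm]; exact hDu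
  -- (K) the commutator `K(h)u`, summed over the torus
  have hK : ∑ z, ∑ a, ∑ b, ‖KhY i (parSymY i) h U u z a b‖ ^ 2
      ≤ (2560 * ((d : ℝ) + 1) * κ ^ 2 * LD + 1024 * (((d : ℝ) + 1) * κ₂) ^ 2 * (LD * LD) + 512 * κb ^ 2 * mD ^ 2 * (LD * LD)) * Q := by
    have hpt := fun z => hs_KhY_apply_le i hG hU hhκ hhκ₂ hhb u z
    refine (Finset.sum_le_sum fun z (_ : z ∈ Finset.univ) => hpt z).trans ?_
    rw [Finset.sum_add_distrib, Finset.sum_add_distrib, ← Finset.mul_sum, ← Finset.mul_sum]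
    have g1 : ∑ z, ∑ μ : Fin (d + 1), (∑ a, ∑ b, ‖cdS i U μ u z a b‖ ^ 2 + ∑ a, ∑ b, ‖cdsS i U μ u z a b‖ ^ 2) ≤ 2 * (160 * LD * Q) := by
      rw [Finset.sum_comm]
      simp only [Finset.sum_add_distrib]
      have h2 : ∑ μ : Fin (d + 1), ∑ z, ∑ a, ∑ b, ‖cdsS i U μ u z a b‖ ^ 2 ≤ ∑ μ : Fin (d + 1), ∑ z, ∑ a, ∑ b, ‖cdS i U μ u z a b‖ ^ 2 :=
        Finset.sum_le_sum fun μ _ => sum_hs_cdsS_le i hG hU μ u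
      linarith
    have g2 : ∑ z, 2 * κb ^ 2 * (((((ℓ + 1) ^ (blkOf i.D.toDomains z).1.1 : ℕ) : ℝ)) ^ 2)⁻¹ * ∑ w', avgCoeffY i z w' * ∑ a, ∑ b, ‖u w' a b‖ ^ 2
        ≤ 2 * κb ^ 2 * (mD ^ 2 * (256 * (LD * LD) * Q)) := by
      have e : ∑ z, 2 * κb ^ 2 * (((((ℓ + 1) ^ (blkOf i.D.toDomains z).1.1 : ℕ) : ℝ)) ^ 2)⁻¹ * ∑ w', avgCoeffY i z w' * ∑ a, ∑ b, ‖u w' a b‖ ^ 2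
          = 2 * κb ^ 2 * ∑ z, ((((((ℓ + 1) ^ (blkOf i.D.toDomains z).1.1 : ℕ) : ℝ)) ^ 2)⁻¹ * ∑ w', avgCoeffY i z w' * ∑ a, ∑ b, ‖u w' a b‖ ^ 2) := by
        rw [Finset.mul_sum]; exact Finset.sum_congr rfl fun z _ => by ring
      rw [e]
      refine mul_le_mul_of_nonneg_left ((sum_levelMass_avg_le i huD hjD').trans ?_) (by positivity)
      exact mul_le_mul_of_nonneg_left huu' (by positivity)
    have g3 : 4 * (((d : ℝ) + 1) * κ₂) ^ 2 * ∑ z, ∑ a, ∑ b, ‖u z a b‖ ^ 2 ≤ 4 * (((d : ℝ) + 1) * κ₂) ^ 2 * (256 * (LD * LD) * Q) :=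
      mul_le_mul_of_nonneg_left huu' (by positivity)
    have g1' : 8 * ((d : ℝ) + 1) * κ ^ 2 * ∑ z, ∑ μ : Fin (d + 1), (∑ a, ∑ b, ‖cdS i U μ u z a b‖ ^ 2 + ∑ a, ∑ b, ‖cdsS i U μ u z a b‖ ^ 2)
        ≤ 8 * ((d : ℝ) + 1) * κ ^ 2 * (2 * (160 * LD * Q)) := mul_le_mul_of_nonneg_left g1 (by positivity)
    have etot : (2560 * ((d : ℝ) + 1) * κ ^ 2 * LD + 1024 * (((d : ℝ) + 1) * κ₂) ^ 2 * (LD * LD) + 512 * κb ^ 2 * mD ^ 2 * (LD * LD)) * Q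
        = 8 * ((d : ℝ) + 1) * κ ^ 2 * (2 * (160 * LD * Q)) + 4 * (((d : ℝ) + 1) * κ₂) ^ 2 * (256 * (LD * LD) * Q)
          + 2 * κb ^ 2 * (mD ^ 2 * (256 * (LD * LD) * Q)) := by ring
    rw [etot]
    exact add_le_add (add_le_add g1' g3) g2
  -- (L) the covariant Laplacian of `w`: `Δ_U w = h²Ψ − K(h)u − (averaging of w)`
  have hlap : ∀ z, lapS i U w z = cutMulY h Ψ' z - KhY i (parSymY i) h U u z
      - ∑ w', ((avgCoeffY i z w' : ℝ) : ℂ) • R (avgTrY i (parSymY i) U z w') (w w') := by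
    intro z
    have e1 : deltaPrimeAY i (parSymY i) U w z = lapS i U w z + ∑ w', ((avgCoeffY i z w' : ℝ) : ℂ) • R (avgTrY i (parSymY i) U z w') (w w') :=
      deltaPrimeAY_apply i (parSymY i) U w z
    have e2 : KhY i (parSymY i) h U u z = ((h z : ℝ) : ℂ) • deltaPrimeAY i (parSymY i) U u z - deltaPrimeAY i (parSymY i) U w z := by
      rw [KhY_def, cutCommY_apply]
    have e3 : ((h z : ℝ) : ℂ) • deltaPrimeAY i (parSymY i) U u z = cutMulY h Ψ' z := by
      by_cases hz : z ∈ D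
      · have hc := congrFun (cubeProjY_deltaPrimeAY_GsqY_apply i hG hU D Ψ') z
        rw [cubeProjY_apply, cubeProjY_apply, if_pos hz, if_pos hz] at hc
        rw [hc, cutMulY_apply]
      · rw [hhD z hz, cutMulY_apply, hhD z hz]; simp
    have e4 : lapS i U w z = deltaPrimeAY i (parSymY i) U w z - ∑ w', ((avgCoeffY i z w' : ℝ) : ℂ) • R (avgTrY i (parSymY i) U z w') (w w') := by
      rw [e1, add_sub_cancel_right]
    rw [e4, ← e3]
    have e5 : deltaPrimeAY i (parSymY i) U w z = ((h z : ℝ) : ℂ) • deltaPrimeAY i (parSymY i) U u z - KhY i (parSymY i) h U u z := by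
      rw [e2]; abel
    rw [e5]
  have hlapHS : ∑ z, ∑ a, ∑ b, ‖lapS i U w z a b‖ ^ 2
      ≤ (4 + 4 * (2560 * ((d : ℝ) + 1) * κ ^ 2 * LD + 1024 * (((d : ℝ) + 1) * κ₂) ^ 2 * (LD * LD) + 512 * κb ^ 2 * mD ^ 2 * (LD * LD))
          + 512 * mD ^ 2 * (LD * LD)) * Q := by
    -- pointwise split
    have hmem : ∀ z w', avgTrY i (parSymY i) U z w' ∈ G := fun z w' => G.mul_mem (parSymY_mem i hU _ _) (parSymY_mem i hU _ _)
    have hpt : ∀ z, ∑ a, ∑ b, ‖lapS i U w z a b‖ ^ 2 ≤ 4 * ∑ a, ∑ b, ‖Ψ z a b‖ ^ 2 + 4 * ∑ a, ∑ b, ‖KhY i (parSymY i) h U u z a b‖ ^ 2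
        + 2 * ((((((ℓ + 1) ^ (blkOf i.D.toDomains z).1.1 : ℕ) : ℝ)) ^ 2)⁻¹ * ∑ w', avgCoeffY i z w' * ∑ a, ∑ b, ‖w w' a b‖ ^ 2) := by
      intro z
      rw [hlap z]
      have h1 := hs_sub_le (cutMulY h Ψ' z - KhY i (parSymY i) h U u z) (∑ w', ((avgCoeffY i z w' : ℝ) : ℂ) • R (avgTrY i (parSymY i) U z w') (w w'))
      have h2 := hs_sub_le (cutMulY h Ψ' z) (KhY i (parSymY i) h U u z)
      have h3 : ∑ a, ∑ b, ‖cutMulY h Ψ' z a b‖ ^ 2 ≤ ∑ a, ∑ b, ‖Ψ z a b‖ ^ 2 :=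
        (hs_cutMulY_apply_le i hh1 Ψ' z).trans (hs_cutMulY_apply_le i hh1 Ψ z)
      have h4 : ∑ a, ∑ b, ‖(∑ w', ((avgCoeffY i z w' : ℝ) : ℂ) • R (avgTrY i (parSymY i) U z w') (w w')) a b‖ ^ 2
          ≤ (((((ℓ + 1) ^ (blkOf i.D.toDomains z).1.1 : ℕ) : ℝ)) ^ 2)⁻¹ * ∑ w', avgCoeffY i z w' * ∑ a, ∑ b, ‖w w' a b‖ ^ 2 := by
        have hcs := hs_sum_smul_le_of_abs_le (N := N) (fun w' => avgCoeffY i z w') (fun w' => avgCoeffY i z w')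
          (fun w' => by rw [abs_of_nonneg (avgCoeffY_nonneg i z w')]) (fun w' => R (avgTrY i (parSymY i) U z w') (w w'))
        refine hcs.trans ?_
        have hR : ∀ w', ∑ a, ∑ b, ‖R (avgTrY i (parSymY i) U z w') (w w') a b‖ ^ 2 ≤ ∑ a, ∑ b, ‖w w' a b‖ ^ 2 := fun w' =>
          hs_R_le (contractive_of_mem_unitary (V := avgTrY i (parSymY i) U z w') (hG (hmem z w'))) (w w')
        refine mul_le_mul (sum_avgCoeffY_le i z) (Finset.sum_le_sum fun w' _ => mul_le_mul_of_nonneg_left (hR w') (avgCoeffY_nonneg i z w'))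
          (Finset.sum_nonneg fun w' _ => mul_nonneg (avgCoeffY_nonneg i z w') (hs_nonneg _)) (by positivity)
      linarith
    refine (Finset.sum_le_sum fun z (_ : z ∈ Finset.univ) => hpt z).trans ?_
    rw [Finset.sum_add_distrib, Finset.sum_add_distrib, ← Finset.mul_sum, ← Finset.mul_sum, ← Finset.mul_sum]
    have a1 : ∑ z, ∑ a, ∑ b, ‖Ψ z a b‖ ^ 2 = Q := (trIP_one_self_eq Ψ).symm
    have a3 := (sum_levelMass_avg_le i hwD hjD').trans (mul_le_mul_of_nonneg_left hww' (by positivity))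
    rw [a1]
    have hsum := add_le_add (add_le_add (le_refl (4 * Q)) (mul_le_mul_of_nonneg_left hK (by norm_num : (0 : ℝ) ≤ 4)))
      (mul_le_mul_of_nonneg_left a3 (by norm_num : (0 : ℝ) ≤ 2))
    exact hsum.trans (le_of_eq (by ring))
  -- (E) the curvature-weighted terms: `ε ≤ ε_D` wherever the weighted function does not vanish
  have hcdS_ne : ∀ (μ : Fin (d + 1)) (Λ : SiteY i → Matrix (Fin N) (Fin N) ℂ) (y : SiteY i),
      cdS i U μ Λ y ≠ 0 → Λ y ≠ 0 ∨ Λ (shiftY i μ y) ≠ 0 := by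
    intro μ Λ y hne
    by_contra hcon
    simp only [not_or, not_not] at hcon
    apply hne
    show R (UboxY i U μ y) (Λ (shiftY i μ y)) - Λ y = 0
    rw [hcon.1, hcon.2, R_zero, sub_zero]
  have hwD' : ∀ y, w y ≠ 0 → y ∈ D := fun y hy => by by_contra hy'; exact hy (hwD y hy')
  have T1 : ∀ μ ν : Fin (d + 1), ∑ z, ε z ^ 2 * ∑ a, ∑ b, ‖w (shiftY i ν (shiftY i μ z)) a b‖ ^ 2 ≤ εD ^ 2 * (256 * (LD * LD) * Q) := by
    intro μ ν
    have hpt : ∀ z, ε z ^ 2 * ∑ a, ∑ b, ‖w (shiftY i ν (shiftY i μ z)) a b‖ ^ 2 ≤ εD ^ 2 * ∑ a, ∑ b, ‖w (shiftY i ν (shiftY i μ z)) a b‖ ^ 2 := by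
      intro z
      by_cases hz : w (shiftY i ν (shiftY i μ z)) = 0
      · rw [hz]; simp
      · have hε := hεD z μ ν (hwD' _ hz)
        exact mul_le_mul_of_nonneg_right (pow_le_pow_left₀ (hε0 z) hε 2) (hs_nonneg _)
    refine (Finset.sum_le_sum fun z _ => hpt z).trans ?_
    rw [← Finset.mul_sum, Fintype.sum_equiv ((shiftY i μ).trans (shiftY i ν)) (fun z => ∑ a, ∑ b, ‖w (shiftY i ν (shiftY i μ z)) a b‖ ^ 2)
      (fun z => ∑ a, ∑ b, ‖w z a b‖ ^ 2) fun z => rfl]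
    exact mul_le_mul_of_nonneg_left hww' (by positivity)
  -- `ε(x) ≤ ε_D` whenever `(∇_νw)(τ_μ x) ≠ 0` or `(∇_μw)(τ_ν x) ≠ 0`
  have hεgrad : ∀ (x : SiteY i) (μ ν : Fin (d + 1)), cdS i U ν w (shiftY i μ x) ≠ 0 → ε x ≤ εD := by
    intro x μ ν hne
    rcases hcdS_ne ν w _ hne with h1 | h1
    · exact hεD' x μ (hwD' _ h1)
    · exact hεD x μ ν (hwD' _ h1)
  have T2 : ∀ μ ν : Fin (d + 1),
      ∑ z, ε ((shiftY i ν).symm z) * (∑ a, ∑ b, ‖cdS i U ν w (shiftY i μ ((shiftY i ν).symm z)) a b‖ ^ 2 + ∑ a, ∑ b, ‖cdS i U μ w z a b‖ ^ 2)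
        ≤ εD * (∑ z, ∑ a, ∑ b, ‖cdS i U ν w z a b‖ ^ 2 + ∑ z, ∑ a, ∑ b, ‖cdS i U μ w z a b‖ ^ 2) := by
    intro μ ν
    -- reindex `z = τ_ν x`
    rw [← Fintype.sum_equiv (shiftY i ν) (fun x => ε x * (∑ a, ∑ b, ‖cdS i U ν w (shiftY i μ x) a b‖ ^ 2 + ∑ a, ∑ b, ‖cdS i U μ w (shiftY i ν x) a b‖ ^ 2))
      (fun z => ε ((shiftY i ν).symm z) * (∑ a, ∑ b, ‖cdS i U ν w (shiftY i μ ((shiftY i ν).symm z)) a b‖ ^ 2 + ∑ a, ∑ b, ‖cdS i U μ w z a b‖ ^ 2))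
      (fun x => by simp only [Equiv.symm_apply_apply])]
    have hpt : ∀ x, ε x * (∑ a, ∑ b, ‖cdS i U ν w (shiftY i μ x) a b‖ ^ 2 + ∑ a, ∑ b, ‖cdS i U μ w (shiftY i ν x) a b‖ ^ 2)
        ≤ εD * ∑ a, ∑ b, ‖cdS i U ν w (shiftY i μ x) a b‖ ^ 2 + εD * ∑ a, ∑ b, ‖cdS i U μ w (shiftY i ν x) a b‖ ^ 2 := by
      intro x
      rw [mul_add]
      refine add_le_add ?_ ?_
      · by_cases hz : cdS i U ν w (shiftY i μ x) = 0
        · rw [hz]; simp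
        · exact mul_le_mul_of_nonneg_right (hεgrad x μ ν hz) (hs_nonneg _)
      · by_cases hz : cdS i U μ w (shiftY i ν x) = 0
        · rw [hz]; simp
        · exact mul_le_mul_of_nonneg_right (hεgrad x ν μ hz) (hs_nonneg _)
    refine (Finset.sum_le_sum fun x _ => hpt x).trans (le_of_eq ?_)
    rw [Finset.sum_add_distrib, ← Finset.mul_sum, ← Finset.mul_sum, mul_add,
      Fintype.sum_equiv (shiftY i μ) (fun x => ∑ a, ∑ b, ‖cdS i U ν w (shiftY i μ x) a b‖ ^ 2) (fun z => ∑ a, ∑ b, ‖cdS i U ν w z a b‖ ^ 2) fun x => rfl,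
      Fintype.sum_equiv (shiftY i ν) (fun x => ∑ a, ∑ b, ‖cdS i U μ w (shiftY i ν x) a b‖ ^ 2) (fun z => ∑ a, ∑ b, ‖cdS i U μ w z a b‖ ^ 2) fun x => rfl]
  -- the covariant gradient of `w = M_h u`
  have hDw : ∀ μ : Fin (d + 1), ∑ z, ∑ a, ∑ b, ‖cdS i U μ w z a b‖ ^ 2 ≤ 2 * ∑ z, ∑ a, ∑ b, ‖cdS i U μ u z a b‖ ^ 2 + 2 * κ ^ 2 * (256 * (LD * LD) * Q) := by
    intro μ
    refine (Finset.sum_le_sum fun z _ => hs_cdS_cutMulY_le i U μ hh1 hhκ u z).trans ?_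
    rw [Finset.sum_add_distrib, ← Finset.mul_sum, ← Finset.mul_sum]
    exact add_le_add le_rfl (mul_le_mul_of_nonneg_left huu' (by positivity))
  have hDwsum : ∑ μ : Fin (d + 1), ∑ z, ∑ a, ∑ b, ‖cdS i U μ w z a b‖ ^ 2 ≤ (320 * LD + 512 * ((d : ℝ) + 1) * κ ^ 2 * (LD * LD)) * Q := by
    refine (Finset.sum_le_sum fun μ _ => hDw μ).trans ?_
    rw [Finset.sum_add_distrib, ← Finset.mul_sum, Finset.sum_const, Finset.card_univ, Fintype.card_fin, nsmul_eq_mul]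
    push_cast
    nlinarith [hDu', hQ0, sq_nonneg κ, show (0:ℝ) ≤ LD * LD * Q by positivity]
  -- the ε-sum: termwise by `T1`, `T2`, then count the `(d+1)²` ∕ `2(d+1)` copies
  have hεsum : ∑ μ : Fin (d + 1), ∑ ν : Fin (d + 1),
      (4 * ∑ z, ε z ^ 2 * ∑ a, ∑ b, ‖w (shiftY i ν (shiftY i μ z)) a b‖ ^ 2
        + ∑ z, ε ((shiftY i ν).symm z) * (∑ a, ∑ b, ‖cdS i U ν w (shiftY i μ ((shiftY i ν).symm z)) a b‖ ^ 2 + ∑ a, ∑ b, ‖cdS i U μ w z a b‖ ^ 2))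
      ≤ (1024 * ((d : ℝ) + 1) ^ 2 * εD ^ 2 * (LD * LD)
          + 2 * ((d : ℝ) + 1) * εD * (320 * LD + 512 * ((d : ℝ) + 1) * κ ^ 2 * (LD * LD))) * Q := by
    have hstep : ∑ μ : Fin (d + 1), ∑ ν : Fin (d + 1),
        (4 * ∑ z, ε z ^ 2 * ∑ a, ∑ b, ‖w (shiftY i ν (shiftY i μ z)) a b‖ ^ 2
          + ∑ z, ε ((shiftY i ν).symm z) * (∑ a, ∑ b, ‖cdS i U ν w (shiftY i μ ((shiftY i ν).symm z)) a b‖ ^ 2 + ∑ a, ∑ b, ‖cdS i U μ w z a b‖ ^ 2))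
        ≤ ∑ μ : Fin (d + 1), ∑ ν : Fin (d + 1), (4 * (εD ^ 2 * (256 * (LD * LD) * Q))
            + εD * ((fun μ' : Fin (d + 1) => ∑ z, ∑ a, ∑ b, ‖cdS i U μ' w z a b‖ ^ 2) ν + (fun μ' : Fin (d + 1) => ∑ z, ∑ a, ∑ b, ‖cdS i U μ' w z a b‖ ^ 2) μ)) :=
      Finset.sum_le_sum fun μ _ => Finset.sum_le_sum fun ν _ => add_le_add (mul_le_mul_of_nonneg_left (T1 μ ν) (by norm_num)) (T2 μ ν)
    refine hstep.trans ?_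
    rw [sum_sum_const_add_pair]
    have h2 : 2 * ((d : ℝ) + 1) * εD * ∑ μ : Fin (d + 1), (fun μ' : Fin (d + 1) => ∑ z, ∑ a, ∑ b, ‖cdS i U μ' w z a b‖ ^ 2) μ
        ≤ 2 * ((d : ℝ) + 1) * εD * ((320 * LD + 512 * ((d : ℝ) + 1) * κ ^ 2 * (LD * LD)) * Q) :=
      mul_le_mul_of_nonneg_left hDwsum (by positivity)
    refine (add_le_add le_rfl h2).trans (le_of_eq ?_)
    ring
  -- assemble with the Bochner–Weitzenböck inequality
  have hB := bochner_le i hG hU hF w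
  have hlapQ : trIP (fun _ => (1 : ℝ)) (lapS i U w) (lapS i U w)
      ≤ (4 + 4 * (2560 * ((d : ℝ) + 1) * κ ^ 2 * LD + 1024 * (((d : ℝ) + 1) * κ₂) ^ 2 * (LD * LD) + 512 * κb ^ 2 * mD ^ 2 * (LD * LD))
          + 512 * mD ^ 2 * (LD * LD)) * Q := by rw [trIP_one_self_eq]; exact hlapHS
  have hfin := add_le_add hlapQ hεsum
  have h43 : (0 : ℝ) ≤ 4 / 3 := by norm_num
  refine hB.trans ((mul_le_mul_of_nonneg_left hfin h43).trans (le_of_eq ?_))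
  ring


/-- the sandwich `M_hG′_□M_h` is trace-symmetric (real multipliers: dag-n06-j's `trIP_cutMulY_right`; `G′_□`: file 19's `isSymmTr_GsqY_parSymY`).
[cite: Balaban1985BackgroundPropagators, Thm 3.11 p.416 («symmetric»), (3.88) p.409] -/
theorem trIP_sandwich_symm (hG : G ≤ B7Prop2Explicit.unitaryUnits (Matrix (Fin N) (Fin N) ℂ)) {U : CfgY (Matrix (Fin N) (Fin N) ℂ) i}
    (hU : ∀ μ x, U μ x ∈ G) (D : Finset (SiteY i)) (h : SiteY i → ℝ) (Φ Ψ : SiteY i → Matrix (Fin N) (Fin N) ℂ) :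
    trIP (fun _ => (1 : ℝ)) (cutMulY h (GsqY i (parSymY i) D U (cutMulY h Φ))) Ψ
      = trIP (fun _ => (1 : ℝ)) Φ (cutMulY h (GsqY i (parSymY i) D U (cutMulY h Ψ))) := by
  rw [← B9Thm311LocalInversePosY.trIP_cutMulY_right, B9Thm31SiteGsqBoundsReg335Y.isSymmTr_GsqY_parSymY i hG hU D,
    B9Thm311LocalInversePosY.trIP_cutMulY_right]

/-- ★★★ **THE SECOND-ORDER MEMBER `M_hG′_□M_h∇*_ν∇*_μ` IN `L²`, □-UNIFORM** (the 𝔸-level shape of dag-n06-k's `L2SecondLegs37.l5`, print's (3.46) fourth member for the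
sandwiched local cube inverse, constant WITHOUT a level factor): under the hypotheses of `hessian_cutMulY_GsqY_cutMulY_le`, for every `λ`,
`‖M_hG′_□M_h∇*_ν∇*_μλ‖² ≤ C_H·‖λ‖²` with `C_H` that theorem's constant (duality `trIP_T_cdsS_cdsS_le_of_hessian`).
[cite: Balaban1985BackgroundPropagators, (3.46) p.398, Cor 3.6 p.408, (3.88) p.409, (3.8) p.392; Balaban1984PropagatorsII, (2.43) p.230] -/
theorem trIP_cutMulY_GsqY_cutMulY_cdsS_cdsS_le [Nonempty (Fin N)] (hG : G ≤ B7Prop2Explicit.unitaryUnits (Matrix (Fin N) (Fin N) ℂ))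
    {U : CfgY (Matrix (Fin N) (Fin N) ℂ) i}
    (hC0 : 0 ≤ c * (kGeo i).M * α₀) (hC1 : c * (kGeo i).M * α₀ * ((d : ℝ) + 1) ≤ 1 / 16) (hreg : (bg9K (Matrix (Fin N) (Fin N) ℂ) G i).Reg335 c α₀ U)
    (D : Finset (SiteY i)) {h : SiteY i → ℝ} {κ κ₂ κb : ℝ} (hh1 : ∀ z, |h z| ≤ 1) (hhκ : ∀ μ z, |h (shiftY i μ z) - h z| ≤ κ)
    (hhκ₂ : ∀ μ z, |h (shiftY i μ z) + h ((shiftY i μ).symm z) - 2 * h z| ≤ κ₂)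
    (hhb : ∀ z w : SiteY i, blkOf i.D.toDomains w = blkOf i.D.toDomains z → |h z - h w| ≤ κb) (hhD : ∀ z, z ∉ D → h z = 0)
    {jD jD' : ℕ} (hjD : ∀ z ∈ D, (blkOf i.D.toDomains z).1.1 ≤ jD) (hjD' : ∀ z ∈ D, jD' ≤ (blkOf i.D.toDomains z).1.1)
    {ε : SiteY i → ℝ} {εD : ℝ} (hε0 : ∀ z, 0 ≤ ε z) (hεD0 : 0 ≤ εD)
    (hF : ∀ μ ν z, ‖((plaqU (shiftY i) (UboxY i U) μ ν z : (Matrix (Fin N) (Fin N) ℂ)ˣ) : Matrix (Fin N) (Fin N) ℂ) - 1‖ ≤ ε z)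
    (hεD : ∀ x μ ν, shiftY i ν (shiftY i μ x) ∈ D → ε x ≤ εD) (hεD' : ∀ x μ, shiftY i μ x ∈ D → ε x ≤ εD)
    (ν μ : Fin (d + 1)) (Λ : SiteY i → Matrix (Fin N) (Fin N) ℂ) :
    trIP (fun _ => (1 : ℝ)) (cutMulY h (GsqY i (parSymY i) D U (cutMulY h (cdsS i U ν (cdsS i U μ Λ)))))
        (cutMulY h (GsqY i (parSymY i) D U (cutMulY h (cdsS i U ν (cdsS i U μ Λ)))))
      ≤ 4 / 3 * (4 + 4 * (2560 * ((d : ℝ) + 1) * κ ^ 2 * ((((ℓ + 1) ^ jD : ℕ) : ℝ)) ^ 2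
              + 1024 * (((d : ℝ) + 1) * κ₂) ^ 2 * (((((ℓ + 1) ^ jD : ℕ) : ℝ)) ^ 2) ^ 2
              + 512 * κb ^ 2 * ((((((ℓ + 1) ^ jD' : ℕ) : ℝ)) ^ 2)⁻¹) ^ 2 * (((((ℓ + 1) ^ jD : ℕ) : ℝ)) ^ 2) ^ 2)
            + 512 * ((((((ℓ + 1) ^ jD' : ℕ) : ℝ)) ^ 2)⁻¹) ^ 2 * (((((ℓ + 1) ^ jD : ℕ) : ℝ)) ^ 2) ^ 2
            + 1024 * ((d : ℝ) + 1) ^ 2 * εD ^ 2 * (((((ℓ + 1) ^ jD : ℕ) : ℝ)) ^ 2) ^ 2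
            + 2 * ((d : ℝ) + 1) * εD * (320 * ((((ℓ + 1) ^ jD : ℕ) : ℝ)) ^ 2 + 512 * ((d : ℝ) + 1) * κ ^ 2 * (((((ℓ + 1) ^ jD : ℕ) : ℝ)) ^ 2) ^ 2))
          * trIP (fun _ => (1 : ℝ)) Λ Λ := by
  have hU : ∀ μ x, U μ x ∈ G := hreg.1
  have hUu : ∀ μ x, (U μ x : Matrix (Fin N) (Fin N) ℂ) ∈ unitary (Matrix (Fin N) (Fin N) ℂ) := fun μ x => hG (hU μ x)
  have hκ0 : 0 ≤ κ := le_trans (abs_nonneg _) (hhκ 0 (Classical.arbitrary _))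
  set CH := 4 / 3 * (4 + 4 * (2560 * ((d : ℝ) + 1) * κ ^ 2 * ((((ℓ + 1) ^ jD : ℕ) : ℝ)) ^ 2
              + 1024 * (((d : ℝ) + 1) * κ₂) ^ 2 * (((((ℓ + 1) ^ jD : ℕ) : ℝ)) ^ 2) ^ 2
              + 512 * κb ^ 2 * ((((((ℓ + 1) ^ jD' : ℕ) : ℝ)) ^ 2)⁻¹) ^ 2 * (((((ℓ + 1) ^ jD : ℕ) : ℝ)) ^ 2) ^ 2)
            + 512 * ((((((ℓ + 1) ^ jD' : ℕ) : ℝ)) ^ 2)⁻¹) ^ 2 * (((((ℓ + 1) ^ jD : ℕ) : ℝ)) ^ 2) ^ 2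
            + 1024 * ((d : ℝ) + 1) ^ 2 * εD ^ 2 * (((((ℓ + 1) ^ jD : ℕ) : ℝ)) ^ 2) ^ 2
            + 2 * ((d : ℝ) + 1) * εD * (320 * ((((ℓ + 1) ^ jD : ℕ) : ℝ)) ^ 2 + 512 * ((d : ℝ) + 1) * κ ^ 2 * (((((ℓ + 1) ^ jD : ℕ) : ℝ)) ^ 2) ^ 2)) with hCH
  have hCH0 : 0 ≤ CH := by positivity
  have hH : ∀ Ψ : SiteY i → Matrix (Fin N) (Fin N) ℂ,
      trIP (fun _ => (1 : ℝ)) (cdS i U μ (cdS i U ν (cutMulY h (GsqY i (parSymY i) D U (cutMulY h Ψ)))))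
          (cdS i U μ (cdS i U ν (cutMulY h (GsqY i (parSymY i) D U (cutMulY h Ψ)))))
        ≤ Real.sqrt CH ^ 2 * trIP (fun _ => (1 : ℝ)) Ψ Ψ := by
    intro Ψ
    rw [Real.sq_sqrt hCH0]
    refine le_trans ?_ (hessian_cutMulY_GsqY_cutMulY_le i hG hC0 hC1 hreg D hh1 hhκ hhκ₂ hhb hhD hjD hjD' hε0 hεD0 hF hεD hεD' Ψ)
    -- one term of the double sum of nonnegative terms
    have hnn : ∀ μ' ν' : Fin (d + 1), 0 ≤ trIP (fun _ => (1 : ℝ))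
        (cdS i U μ' (cdS i U ν' (cutMulY h (GsqY i (parSymY i) D U (cutMulY h Ψ)))))
        (cdS i U μ' (cdS i U ν' (cutMulY h (GsqY i (parSymY i) D U (cutMulY h Ψ))))) := fun μ' ν' => trIP_self_nonneg _ (fun _ => one_pos) _
    calc _ ≤ ∑ ν' : Fin (d + 1), trIP (fun _ => (1 : ℝ))
          (cdS i U μ (cdS i U ν' (cutMulY h (GsqY i (parSymY i) D U (cutMulY h Ψ)))))
          (cdS i U μ (cdS i U ν' (cutMulY h (GsqY i (parSymY i) D U (cutMulY h Ψ))))) :=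
            Finset.single_le_sum (f := fun ν' => trIP (fun _ => (1 : ℝ))
              (cdS i U μ (cdS i U ν' (cutMulY h (GsqY i (parSymY i) D U (cutMulY h Ψ)))))
              (cdS i U μ (cdS i U ν' (cutMulY h (GsqY i (parSymY i) D U (cutMulY h Ψ)))))) (fun ν' _ => hnn μ ν') (Finset.mem_univ ν)
      _ ≤ _ := Finset.single_le_sum (f := fun μ' => ∑ ν' : Fin (d + 1), trIP (fun _ => (1 : ℝ))
              (cdS i U μ' (cdS i U ν' (cutMulY h (GsqY i (parSymY i) D U (cutMulY h Ψ)))))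
              (cdS i U μ' (cdS i U ν' (cutMulY h (GsqY i (parSymY i) D U (cutMulY h Ψ))))))
            (fun μ' _ => Finset.sum_nonneg fun ν' _ => hnn μ' ν') (Finset.mem_univ μ)
  have hdual := trIP_T_cdsS_cdsS_le_of_hessian i hUu (T := fun Φ => cutMulY h (GsqY i (parSymY i) D U (cutMulY h Φ)))
    (fun Φ Ψ => trIP_sandwich_symm i hG hU D h Φ Ψ) μ ν (Real.sqrt_nonneg CH) hH Λ
  rw [Real.sq_sqrt hCH0] at hdual
  exact hdual
end Hessian

end Literature.MathematicalPhysics.QuantumFieldTheory.Balaban1983to89.B9Thm31SiteGsqHessianReg335Y
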